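import Mathlib
import HarnessLib
import Summits.NavierStokesRegularity.NavierStokesRegularity.Theorems.HalfSpaceWindowDoorCirculationCarryingRigidityDefs
import Summits.NavierStokesRegularity.NavierStokesRegularity.Theorems.HalfSpaceWindowDoorCirculationCarryingRigidityRotHeadLiouville
import Summits.NavierStokesRegularity.NavierStokesRegularity.Theorems.HalfSpaceWindowDoorCirculationCarryingRigidityAsymptoticPlanarity
import Summits.NavierStokesRegularity.NavierStokesRegularity.Theorems.PoloidalWindowDoorPoloidalWindowRigidityWindow
import Summits.NavierStokesRegularity.NavierStokesRegularity.Theorems.PoloidalWindowDoorPoloidalWindowRigidityFlat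
import Summits.NavierStokesRegularity.NavierStokesRegularity.Theorems.PoloidalWindowDoorPoloidalWindowRigidityClassSpaceTimeRates
import Literature.Analysis.FluidPDE.TypeIAncientMildClassical
import Literature.Analysis.FluidPDE.VorticityCalculus

/-!
# Route `HalfSpaceWindowDoor`, crux `CirculationCarryingRigidity` (stmt-NavierStokesRegularity-25311) — line
# `rot_bernoulli`, VIII: OFF-AXIS — rotation about ANY similarity-fixed vertical axis (the moving axes `x_h = √(−t)·y₀`)

LEAD ns-hsw-p1 g11 (cell pub-ns-dss).  Line `eddy_covariance` (g10, Row 4) observed that the vertical axes which stay put in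
similarity variables are the rays `x_h = √(−t)·y₀`, and typed the circle law about them.  For the rotation-corrected Bernoulli
function the same extension is FREE: a profile rotating (in similarity variables) with angular speed `α` about the vertical
axis through `y₀` solves the rotated Leray system WITH A CONSTANT DRIFT `c = αJy₀`,
`−νΔU + aU + a(y·∇)U + (c·∇)U + (U·∇)U + ∇P + α(JU − (Jy·∇)U) = 0`,
and the substitution `Ũ = U + c`, `P̃ = P − ⟪a c + αJc, ·⟫` turns it into the centred system for `(Ũ, P̃)` (same vorticity,
same gradient, `P̃` still polynomially bounded).  Hence:

* `exists_eq_const_of_rotProfile_drift` (any finite-dimensional inner product space, any skew `J`, ANY constant drift `c`):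
  bounded `C³` solutions with `C²` polynomially bounded pressure and `α·tr(J∘DU) ≥ 0` are constant;
* `eq_zero_of_instantRSS_drift` — the same with ANY constant similarity drift `c` (off-centre axis `c = αJy₀` and/or axial
  log-drift `c = βe₃`, i.e. screw-type self-similar motion): door class + slice sign + one-instant identity + `α ≤ 0` ⇒ `v ≡ 0`;
* `eq_zero_of_instantRSS_offAxis` — a door-class profile whose vertical vorticity is `≥ 0` on the slice `t = −1` and whose
  time derivative at `t = −1` is the generator of rotated self-similarity ABOUT THE VERTICAL AXIS THROUGH `y₀`,
  `∂ₜv(−1,x) = ½v + ½(x·∇)v + α(e₃×v − ((e₃×(x − y₀))·∇)v)` (at `t = −1` the axis `√(−t)y₀` passes through `y₀`), with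
  `α ≤ 0`, vanishes identically; `not_isBackwardSingularPoint_of_instantRSS_offAxis`,
  `hemisphereLiouvilleE3_of_instantRSS_offAxis` (W6 restricted, hypotheses verbatim), `alpha_pos_of_instantRSS_offAxis_ne_zero`
  (ENEMY FORM: an enemy instantaneously rotated-self-similar about SOME similarity-fixed vertical axis co-rotates there).

WHAT THIS IS NOT: not a statement about Navier–Stokes regularity (Clay A); the door statements concern HYPOTHETICAL blow-up
profiles (KNSS ancient mild solutions); helper `--supports` 25311; the item stays OPEN at its research stub.
-/

noncomputable section

-- the summit and its single sub-problem share the name (CONVENTIONS §1), as in every Theorems file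
set_option linter.dupNamespace false

namespace Summit.NavierStokesRegularity.NavierStokesRegularity.Theorems.HalfSpaceWindowDoorCirculationCarryingRigidityRotHeadOffAxis

open Set Function Filter Topology InnerProductSpace
open scoped RealInnerProductSpace Laplacian ContDiff
open Literature.Analysis Literature.Analysis.FluidPDE
open Summit.NavierStokesRegularity.NavierStokesRegularity.Theorems.HalfSpaceWindowDoorCirculationCarryingRigidityDefs
  (InDoorClass SignE3 e3 HemisphereLiouvilleE3)
open Summit.NavierStokesRegularity.NavierStokesRegularity.Theorems.HalfSpaceWindowDoorCirculationCarryingRigidityRotHeadLiouville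
  (exists_eq_const_of_rotProfile)
open Summit.NavierStokesRegularity.NavierStokesRegularity.Theorems.HalfSpaceWindowDoorCirculationCarryingRigidityRotHead
  (rotGenL_skew traceCLM_rotGenL_comp_fderiv)
open Summit.NavierStokesRegularity.NavierStokesRegularity.Theorems.HalfSpaceWindowDoorCirculationCarryingRigidityAsymptoticPlanarity
  (eq_zero_of_lineInvariant_slice)
open Summit.NavierStokesRegularity.NavierStokesRegularity.Theorems.PoloidalWindowDoorPoloidalWindowRigidityWindow
  (isTypeIAncientMild_of_class)
open Summit.NavierStokesRegularity.NavierStokesRegularity.Theorems.PoloidalWindowDoorPoloidalWindowRigidityClassSpaceTimeRates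
  (exists_pressureGradient_rate_of_class)
open Summit.NavierStokesRegularity.NavierStokesRegularity.Theorems.PoloidalWindowDoorPoloidalWindowRigidityFlat
  (not_backwardSingular_of_zero)

variable {E : Type*} [NormedAddCommGroup E] [InnerProductSpace ℝ E] [FiniteDimensional ℝ E]

/-! ### Constant drifts are removable -/

/-- **Rotated Leray profiles with a constant drift are constant** (bounded, `C²` polynomially bounded pressure,
`α·tr(J∘DU) ≥ 0`): the substitution `Ũ = U + c`, `P̃ = P − ⟪a c + αJc, ·⟫` removes the drift `(c·∇)U`, and
`…RotHeadLiouville.exists_eq_const_of_rotProfile` applies to `(Ũ, P̃)`. -/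
theorem exists_eq_const_of_rotProfile_drift [MeasurableSpace E] [BorelSpace E] {ν a α : ℝ} (hν : 0 < ν) (ha : 0 < a)
    {J : E →L[ℝ] E} (hJ : ∀ v w, ⟪J v, w⟫ = -⟪v, J w⟫) {U : E → E} {P : E → ℝ} (c : E)
    (hU3 : ContDiff ℝ 3 U) (hP2 : ContDiff ℝ 2 P) (hdiv : VectorCalculus.IsDivFree U)
    (heq : ∀ y, -(ν • (Δ U) y) + a • U y + a • fderiv ℝ U y y + fderiv ℝ U y c + convect U U y + gradient P y +
      α • (J (U y) - fderiv ℝ U y (J y)) = 0)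
    (hUbdd : ∃ M : ℝ, ∀ y, ‖U y‖ ≤ M) (hPpoly : ∃ C : ℝ, ∃ N : ℕ, ∀ y, |P y| ≤ C * (1 + ‖y‖) ^ N)
    (hsign : ∀ y, 0 ≤ α * traceCLM (J.comp (fderiv ℝ U y))) :
    ∃ c₀ : E, ∀ y, U y = c₀ := by
  haveI : CompleteSpace E := FiniteDimensional.complete ℝ E
  -- the shifted profile and pressure
  set d : E := a • c + α • J c with hd
  set V : E → E := fun y => U y + c with hV
  set Q : E → ℝ := fun y => P y - ⟪d, y⟫ with hQ
  have hU2 : ContDiff ℝ 2 U := hU3.of_le (by norm_num)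
  have hU1 : ContDiff ℝ 1 U := hU3.of_le (by norm_num)
  have hUd : Differentiable ℝ U := hU1.differentiable one_ne_zero
  have hV3 : ContDiff ℝ 3 V := hU3.add contDiff_const
  have hlin : ContDiff ℝ 2 fun y : E => ⟪d, y⟫ := (contDiff_const.inner ℝ contDiff_id)
  have hQ2 : ContDiff ℝ 2 Q := hP2.sub hlin
  have hDV : ∀ y, fderiv ℝ V y = fderiv ℝ U y := fun y => by
    rw [hV]
    exact fderiv_add_const c
  have hΔV : ∀ y, (Δ V) y = (Δ U) y := fun y => by
    have h : V = U + fun _ => c := rfl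
    rw [h, hU2.contDiffAt.laplacian_add contDiff_const.contDiffAt, laplacian_const_eq_zero, add_zero]
  have hdivV : VectorCalculus.IsDivFree V := fun y => by
    rw [VectorCalculus.divergence, hDV]
    exact hdiv y
  have hφ : (fun z : E => ⟪d, z⟫) = ⇑(InnerProductSpace.toDual ℝ E d) := by
    funext z
    simp
  have hPdiff : Differentiable ℝ P := (hP2.of_le one_le_two).differentiable one_ne_zero
  have hgradQ : ∀ y, gradient Q y = gradient P y - d := fun y => by
    have hld : DifferentiableAt ℝ (fun z : E => ⟪d, z⟫) y := by
      rw [hφ]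
      exact (InnerProductSpace.toDual ℝ E d).differentiableAt
    simp only [hQ, gradient]
    rw [fderiv_fun_sub (hPdiff y) hld, map_sub, hφ, ContinuousLinearMap.fderiv, LinearIsometryEquiv.symm_apply_apply]
  have heqV : ∀ y, -(ν • (Δ V) y) + a • V y + a • fderiv ℝ V y y + convect V V y + gradient Q y +
      α • (J (V y) - fderiv ℝ V y (J y)) = 0 := fun y => by
    have h := heq y
    rw [convect_apply] at h
    rw [hΔV, hDV, hgradQ, convect_apply, hDV]
    simp only [hV]
    rw [← h, hd, map_add, map_add]
    simp only [smul_add, smul_sub]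
    abel
  have hVbdd : ∃ M : ℝ, ∀ y, ‖V y‖ ≤ M := by
    obtain ⟨M, hM⟩ := hUbdd
    exact ⟨M + ‖c‖, fun y => (norm_add_le _ _).trans (by linarith [hM y])⟩
  have hQpoly : ∃ C : ℝ, ∃ N : ℕ, ∀ y, |Q y| ≤ C * (1 + ‖y‖) ^ N := by
    obtain ⟨C, N, hC⟩ := hPpoly
    have hC0 : 0 ≤ C := by
      have h := (abs_nonneg _).trans (hC 0)
      simpa using h
    refine ⟨C + ‖d‖, N + 1, fun y => ?_⟩
    have ht1 : 1 ≤ 1 + ‖y‖ := by linarith [norm_nonneg y]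
    have h1 : |P y| ≤ C * (1 + ‖y‖) ^ (N + 1) :=
      (hC y).trans (mul_le_mul_of_nonneg_left (pow_le_pow_right₀ ht1 (Nat.le_succ N)) hC0)
    have h2 : |⟪d, y⟫| ≤ ‖d‖ * (1 + ‖y‖) ^ (N + 1) := by
      calc |⟪d, y⟫| ≤ ‖d‖ * ‖y‖ := abs_real_inner_le_norm _ _
        _ ≤ ‖d‖ * (1 + ‖y‖) ^ (N + 1) := by
          refine mul_le_mul_of_nonneg_left ?_ (norm_nonneg _)
          calc ‖y‖ ≤ 1 + ‖y‖ := by linarith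
            _ = (1 + ‖y‖) ^ 1 := (pow_one _).symm
            _ ≤ (1 + ‖y‖) ^ (N + 1) := pow_le_pow_right₀ ht1 (by omega)
    calc |Q y| = |P y - ⟪d, y⟫| := rfl
      _ ≤ |P y| + |⟪d, y⟫| := abs_sub _ _
      _ ≤ C * (1 + ‖y‖) ^ (N + 1) + ‖d‖ * (1 + ‖y‖) ^ (N + 1) := add_le_add h1 h2
      _ = (C + ‖d‖) * (1 + ‖y‖) ^ (N + 1) := by ring
  have hsignV : ∀ y, 0 ≤ α * traceCLM (J.comp (fderiv ℝ V y)) := fun y => by rw [hDV]; exact hsign y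
  obtain ⟨c₀, hc₀⟩ := exists_eq_const_of_rotProfile hν ha hJ hV3 hQ2 hdivV heqV hVbdd hQpoly hsignV
  exact ⟨c₀ - c, fun y => by rw [← hc₀ y, hV]; simp⟩

/-! ### `ℝ³`: instantaneous rotated self-similarity about the vertical axis through `y₀` -/

variable {C : ℝ} {v : ℝ → EuclideanSpace ℝ (Fin 3) → EuclideanSpace ℝ (Fin 3)}

/-- **Instantaneous counter-rotating self-similarity UP TO A CONSTANT SIMILARITY DRIFT kills.**  Let `v` be a door-class
profile with `(curl v(−1))₂ ≥ 0` whose time derivative at `t = −1` is the rotated-self-similar generator plus a constant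
drift `c` (in similarity variables: rotation about an off-centre vertical axis, `c = αJy₀`, and/or an axial log-drift
`c = βe₃`): `∂ₜv(−1,x) = ½v + ½(x·∇)v + (c·∇)v + α(e₃×v − ((e₃×x)·∇)v)` for all `x`, with `α ≤ 0`.  Then `v ≡ 0`. -/
theorem eq_zero_of_instantRSS_drift (hv : InDoorClass C v) (hsign : ∀ y, 0 ≤ curl (v (-1)) y 2) {α : ℝ} (hα : α ≤ 0)
    (c : EuclideanSpace ℝ (Fin 3))
    (hgen : ∀ x, deriv (fun τ => v τ x) (-1) = (1 / 2 : ℝ) • v (-1) x + (1 / 2 : ℝ) • fderiv ℝ (v (-1)) x x +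
      fderiv ℝ (v (-1)) x c + α • (rotGen (v (-1) x) - fderiv ℝ (v (-1)) x (rotGen x))) :
    ∀ t < 0, ∀ x, v t x = 0 := by
  obtain ⟨hrate, hcont, hmild, hdiv⟩ := hv
  have hA : IsTypeIAncientMild C v := isTypeIAncientMild_of_class hrate hcont hmild hdiv
  have h1 : (-1 : ℝ) < 0 := by norm_num
  have hmem : (-1 : ℝ) ∈ Ioo (-2 : ℝ) 0 := ⟨by norm_num, by norm_num⟩
  set U : EuclideanSpace ℝ (Fin 3) → EuclideanSpace ℝ (Fin 3) := v (-1) with hU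
  have hU3 : ContDiff ℝ 3 U := contDiff_infty.1 (hA.contDiff_slice h1) 3
  have hdivU : VectorCalculus.IsDivFree U := hdiv (-1) h1
  have hUbdd : ∃ M : ℝ, ∀ y, ‖U y‖ ≤ M := ⟨C, fun y => by
    have h := hA.norm_le h1 y
    rwa [neg_neg, Real.sqrt_one, div_one] at h⟩
  obtain ⟨p, hns⟩ := hA.exists_isClassicalNSSolutionOn_Ioo (t₀ := -2) (by norm_num)
  obtain ⟨K, hK0, hK⟩ := exists_pressureGradient_rate_of_class hrate hcont hmild
  have hgradK : ∀ y, ‖gradient (p (-1)) y‖ ≤ K := fun y => by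
    have h := hK (-2) p hns (-1) hmem y
    rwa [neg_neg, Real.sqrt_one, mul_one, div_one] at h
  have hP2 : ContDiff ℝ 2 (p (-1)) := (hns.contDiff_pressure hmem).of_le (by norm_cast)
  have hPd : Differentiable ℝ (p (-1)) := (hP2.of_le one_le_two).differentiable one_ne_zero
  have hfd : ∀ z, ‖fderiv ℝ (p (-1)) z‖ ≤ K := fun z => by
    refine ContinuousLinearMap.opNorm_le_bound _ hK0 fun w => ?_
    have h : fderiv ℝ (p (-1)) z w = ⟪gradient (p (-1)) z, w⟫ := by
      rw [gradient, InnerProductSpace.toDual_symm_apply]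
    rw [h]
    exact (abs_real_inner_le_norm _ _).trans (mul_le_mul_of_nonneg_right (hgradK z) (norm_nonneg _))
  have hPpoly : ∃ K' : ℝ, ∃ N : ℕ, ∀ y, |p (-1) y| ≤ K' * (1 + ‖y‖) ^ N := by
    refine ⟨|p (-1) 0| + K, 1, fun y => ?_⟩
    have hmv : ‖p (-1) y - p (-1) 0‖ ≤ K * ‖y - 0‖ :=
      (convex_univ).norm_image_sub_le_of_norm_fderiv_le (fun z _ => hPd z) (fun z _ => hfd z) (mem_univ 0) (mem_univ y)
    rw [sub_zero, Real.norm_eq_abs] at hmv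
    have h2 : |p (-1) y| ≤ |p (-1) 0| + K * ‖y‖ := by
      have := abs_sub_abs_le_abs_sub (p (-1) y) (p (-1) 0)
      linarith
    rw [pow_one]
    nlinarith [abs_nonneg (p (-1) 0), norm_nonneg y]
  -- the rotated Leray system with the constant drift `c`
  have heq : ∀ y, -((1 : ℝ) • (Δ U) y) + (1 / 2 : ℝ) • U y + (1 / 2 : ℝ) • fderiv ℝ U y y +
      fderiv ℝ U y c + convect U U y + gradient (p (-1)) y +
      α • (rotGenL (U y) - fderiv ℝ U y (rotGenL y)) = 0 := fun y => by
    have hmom := hns.momentum (-1) hmem y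
    simp only [one_smul, Pi.zero_apply, add_zero] at hmom
    have htd : timeDerivWithin (Ioo (-2 : ℝ) 0) v (-1) y = deriv (fun τ => v τ y) (-1) := by
      rw [timeDerivWithin, derivWithin_of_isOpen isOpen_Ioo hmem]
    rw [htd, hgen y] at hmom
    simp only [← rotGenL_apply] at hmom
    rw [← sub_eq_zero] at hmom
    rw [one_smul, ← hmom]
    abel
  obtain ⟨c₀, hc₀⟩ := exists_eq_const_of_rotProfile_drift one_pos (by norm_num : (0 : ℝ) < 1 / 2) rotGenL_skew
    c hU3 hP2 hdivU heq hUbdd hPpoly (fun y => by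
      rw [traceCLM_rotGenL_comp_fderiv, mul_neg]
      exact neg_nonneg.2 (mul_nonpos_of_nonpos_of_nonneg hα (hsign y)))
  have he3 : e3 ≠ 0 := fun h => by
    have h2 := congrArg (fun w : EuclideanSpace ℝ (Fin 3) => w 2) h
    simp [e3] at h2
  exact eq_zero_of_lineInvariant_slice hA h1 he3 fun x θ => by
    change U (x + θ • e3) = U x
    rw [hc₀, hc₀]

/-- **Instantaneous counter-rotating self-similarity about ANY similarity-fixed vertical axis kills** (the case `c = αJy₀`):
a door-class profile with `(curl v(−1))₂ ≥ 0` and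
`∂ₜv(−1,x) = ½v + ½(x·∇)v + α(e₃×v − ((e₃×(x − y₀))·∇)v)` for all `x` (the generator of rotated self-similarity about the
vertical axis through `y₀`; at `t = −1` the moving axis `√(−t)y₀` passes through `y₀`), `α ≤ 0`, vanishes on the slab. -/
theorem eq_zero_of_instantRSS_offAxis (hv : InDoorClass C v) (hsign : ∀ y, 0 ≤ curl (v (-1)) y 2) {α : ℝ} (hα : α ≤ 0)
    (y₀ : EuclideanSpace ℝ (Fin 3))
    (hgen : ∀ x, deriv (fun τ => v τ x) (-1) = (1 / 2 : ℝ) • v (-1) x + (1 / 2 : ℝ) • fderiv ℝ (v (-1)) x x +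
      α • (rotGen (v (-1) x) - fderiv ℝ (v (-1)) x (rotGen (x - y₀)))) :
    ∀ t < 0, ∀ x, v t x = 0 := by
  refine eq_zero_of_instantRSS_drift hv hsign hα (α • rotGen y₀) fun x => ?_
  rw [hgen x]
  simp only [← rotGenL_apply, map_sub, map_smul, smul_sub]
  abel

/-- … hence NOT backward singular at the apex. -/
theorem not_isBackwardSingularPoint_of_instantRSS_offAxis (hv : InDoorClass C v) (hsign : ∀ y, 0 ≤ curl (v (-1)) y 2)
    {α : ℝ} (hα : α ≤ 0) (y₀ : EuclideanSpace ℝ (Fin 3))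
    (hgen : ∀ x, deriv (fun τ => v τ x) (-1) = (1 / 2 : ℝ) • v (-1) x + (1 / 2 : ℝ) • fderiv ℝ (v (-1)) x x +
      α • (rotGen (v (-1) x) - fderiv ℝ (v (-1)) x (rotGen (x - y₀)))) :
    ¬ IsBackwardSingularPoint v 0 :=
  not_backwardSingular_of_zero (eq_zero_of_instantRSS_offAxis hv hsign hα y₀ hgen)

/-- **W6 = `HemisphereLiouvilleE3` RESTRICTED TO PROFILES INSTANTANEOUSLY COUNTER-ROTATING-SELF-SIMILAR ABOUT SOME SIMILARITY-FIXED
VERTICAL AXIS** (hypotheses of `HemisphereLiouvilleE3` verbatim, plus the one-instant identity about the axis through `y₀` with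
`α ≤ 0`). -/
theorem hemisphereLiouvilleE3_of_instantRSS_offAxis (C : ℝ) (v : ℝ → EuclideanSpace ℝ (Fin 3) → EuclideanSpace ℝ (Fin 3))
    (hrate : HasTypeITimeDecay C v) (hcont : ContinuousOn (Function.uncurry v) (Set.Iio (0 : ℝ) ×ˢ Set.univ))
    (hmild : ∀ s t : ℝ, s < t → t < 0 → ∀ x,
      v t x = UnboundedOperators.heatExtension (v s) (t - s) x - oseenDuhamel 1 s v v t x)
    (hdiv : ∀ t < 0, VectorCalculus.IsDivFree (v t)) (hsign : ∀ s < 0, ∀ y, 0 ≤ ⟪curl (v s) y, e3⟫)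
    {α : ℝ} (hα : α ≤ 0) (y₀ : EuclideanSpace ℝ (Fin 3))
    (hgen : ∀ x, deriv (fun τ => v τ x) (-1) = (1 / 2 : ℝ) • v (-1) x + (1 / 2 : ℝ) • fderiv ℝ (v (-1)) x x +
      α • (rotGen (v (-1) x) - fderiv ℝ (v (-1)) x (rotGen (x - y₀)))) :
    ∀ s < 0, ∀ y, ⟪curl (v s) y, e3⟫ = 0 := by
  have hsign1 : ∀ y, 0 ≤ curl (v (-1)) y 2 := fun y => by
    simpa [e3, EuclideanSpace.inner_single_right] using hsign (-1) (by norm_num) y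
  intro s hs y
  have hz : v s = 0 := funext fun x => eq_zero_of_instantRSS_offAxis ⟨hrate, hcont, hmild, hdiv⟩ hsign1 hα y₀ hgen s hs x
  rw [hz, curl_zero]
  simp

/-- **ENEMY FORM.**  A door-class profile with one-signed vertical vorticity on the slice `t = −1` and a non-zero value, which is
instantaneously rotated-self-similar at `t = −1` about the vertical axis through some `y₀`, CO-ROTATES there: `α > 0`. -/
theorem alpha_pos_of_instantRSS_offAxis_ne_zero (hv : InDoorClass C v) (hsign : ∀ y, 0 ≤ curl (v (-1)) y 2)
    (hne : ∃ t < 0, ∃ x, v t x ≠ 0) {α : ℝ} (y₀ : EuclideanSpace ℝ (Fin 3))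
    (hgen : ∀ x, deriv (fun τ => v τ x) (-1) = (1 / 2 : ℝ) • v (-1) x + (1 / 2 : ℝ) • fderiv ℝ (v (-1)) x x +
      α • (rotGen (v (-1) x) - fderiv ℝ (v (-1)) x (rotGen (x - y₀)))) : 0 < α := by
  by_contra hle
  push Not at hle
  obtain ⟨t, ht, x, hx⟩ := hne
  exact hx (eq_zero_of_instantRSS_offAxis hv hsign hle y₀ hgen t ht x)

end Summit.NavierStokesRegularity.NavierStokesRegularity.Theorems.HalfSpaceWindowDoorCirculationCarryingRigidityRotHeadOffAxis

end
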